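import Summits.Ventures.CertifiedArithmetic.LowPrec.AccumulateSharp

/-!
# Binade floors of node arguments (`ufpN`), node predicates, and the Lange–Rump bookkeeping

HONEST FRAMING (venture CertifiedArithmetic / cell `pub-lowprec`): certified error envelopes and
provably optimal rounding/accumulation schemes for low-precision formats under stated cost models;
every table by two implementations; no hardware or vendor claims.

Toolkit for `AccumulateLangeRump.lean` (the sharp any-order summation bound
`|ŝ - s| ≤ k·u/(1+k·u)·Σ|xᵢ|`, [BoldoEtAl2023, Thm 4.5] after Lange–Rump [LangeRump2018]):
* `ufpN α y` — Rump's unit in the first place `ufp(y)` of an argument `y`, as a rational, set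
  to `0` on the exact range `|y| < 2^(m+1)·quantum`; local facts for an in-range rounded sum of
  two data of `α`: `|e| ≤ u·ufpN(y)` (`abs_err_roundNE_add_le_ufpN`), the floors are totally
  ordered by doubling (`two_mul_ufpN_le_of_lt`), `ufpN(y) ≤ |y|` and `±ufpN(y) ∈ F_α`, hence
  `|e| + ufpN(y) ≤ |y|` (`abs_err_add_ufpN_le_abs`);
* evaluation-tree bookkeeping over the Jeannerod–Rump `SumTree`: `numNodes` (`= n - 1`),
  `AllNodes` / `SomeNode` (predicates on the nodes' exact arguments), `maxUfp`, the cap lemma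
  `absErr_le_numNodes_mul` (`Σ|e_v| ≤ numNodes·u·C` when every floor is `≤ C`);
* the two pure-arithmetic bookkeeping inequalities of the Lange–Rump induction
  (`langeRump_base_arith`, `langeRump_step_arith`).
-/

namespace Literature.ComputerArithmetic.FloatingPoint

namespace MiniFloat

open Literature.ComputerArithmetic.JeannerodRump2018
open Literature.ComputerArithmetic.JeannerodRump2018.SumTree

variable {α : Format}

/-! ### `ufpN`: the binade floor of an argument, truncated to `0` on the exact range -/

/-- `ufpN α y`: Rump's "unit in the first place" `ufp(y) = 2^⌊log₂|y|⌋` as a rational, for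
arguments in the rounding range `|y| ≥ 2^(m+1)·quantum` (spacing `≥ 2` quanta), and `0` below it
(where a sum of two data of `α` is exact). [folklore] -/
noncomputable def ufpN (α : Format) (y : ℚ) : ℚ :=
  if |y| < 2 ^ (α.manBits + 1) * α.quantum then 0
  else 2 ^ (α.manBits + α.shift ⌊|y| / α.quantum⌋.toNat) * α.quantum

/-- `ufpN ≥ 0`. [folklore] -/
theorem ufpN_nonneg (α : Format) (y : ℚ) : 0 ≤ ufpN α y := by
  unfold ufpN
  split_ifs
  · exact le_rfl
  · exact mul_nonneg (by positivity) α.quantum_pos.le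

/-- LOCAL FACT (half an ulp): an in-range rounded sum of two data errs by at most `u · ufpN` of its
exact argument (zero error below `2^(m+1)` quanta, half the spacing `2u·ufp` above).
[cite: Higham2002ASNA, Thm 2.2 and §2.6] -/
theorem abs_err_roundNE_add_le_ufpN (hα : 2 ≤ α.emaxCode) (a b : MiniFloat α)
    (h : |a.toRat + b.toRat| ≤ α.maxRat) :
    |(roundNE α (a.toRat + b.toRat)).toRat - (a.toRat + b.toRat)|
      ≤ α.unitRoundoff * ufpN α (a.toRat + b.toRat) := by
  unfold ufpN
  split_ifs with hsmall
  · have h0 := errAdd_eq_zero_of_small hα a b hsmall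
    unfold errAdd at h0
    rw [h0, abs_zero, mul_zero]
  · rw [abs_sub_comm]
    refine le_trans (abs_sub_roundNE_le_half_spacing h) (le_of_eq ?_)
    rw [Format.unitRoundoff_eq, pow_add, pow_succ]
    field_simp
    ring

/-- The binade floors are `0` or powers of two times `2^m` quanta, hence totally ordered by
doubling: `ufpN y < ufpN y'` forces `2 · ufpN y ≤ ufpN y'`. [folklore] -/
theorem two_mul_ufpN_le_of_lt {y y' : ℚ} (hlt : ufpN α y < ufpN α y') :
    2 * ufpN α y ≤ ufpN α y' := by
  have hq := α.quantum_pos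
  unfold ufpN at hlt ⊢
  split_ifs at hlt ⊢ with h1 h2 h2
  · simp at hlt
  · rw [mul_zero]; positivity
  · exfalso
    have : (0 : ℚ) ≤ 2 ^ (α.manBits + α.shift ⌊|y| / α.quantum⌋.toNat) * α.quantum := by positivity
    linarith
  · -- both powers: compare exponents
    set s := α.shift ⌊|y| / α.quantum⌋.toNat
    set s' := α.shift ⌊|y'| / α.quantum⌋.toNat
    have hlt' : (2 : ℚ) ^ (α.manBits + s) < 2 ^ (α.manBits + s') := lt_of_mul_lt_mul_right hlt hq.le
    have hss : α.manBits + s < α.manBits + s' :=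
      (pow_lt_pow_iff_right₀ (by norm_num : (1 : ℚ) < 2)).mp hlt'
    have hle : (2 : ℚ) ^ (α.manBits + s + 1) ≤ 2 ^ (α.manBits + s') :=
      pow_le_pow_right₀ (by norm_num) (by omega)
    rw [pow_succ] at hle
    nlinarith

/-- The binade floor lies below the argument: `ufpN y ≤ |y|`. [folklore] -/
theorem ufpN_le_abs (y : ℚ) : ufpN α y ≤ |y| := by
  have hq := α.quantum_pos
  unfold ufpN
  split_ifs with hsmall
  · exact abs_nonneg y
  · have hr := scaledInput_nonneg (φ := α) y
    have hge : (2 : ℚ) ^ (α.manBits + 1) ≤ |y| / α.quantum := by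
      rw [le_div_iff₀ hq]; exact not_lt.mp hsmall
    have key : (2 : ℚ) ^ (α.manBits + α.shift ⌊|y| / α.quantum⌋.toNat) ≤ |y| / α.quantum := by
      rcases Format.shift_floor_dichotomy (φ := α) hr with hs | hfloor
      · rw [hs, add_zero]
        exact le_trans (pow_le_pow_right₀ (by norm_num) (Nat.le_succ _)) hge
      · exact hfloor
    have := mul_le_mul_of_nonneg_right key hq.le
    rwa [div_mul_cancel₀ _ (ne_of_gt hq)] at this

/-- In range, the binade floor is the value of a datum of `α` (a power of two within range, or
`0`). [folklore] -/
theorem exists_toRat_eq_ufpN {y : ℚ} (hy : |y| ≤ α.maxRat) :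
    ∃ z : MiniFloat α, z.toRat = ufpN α y := by
  have hq := α.quantum_pos
  by_cases hsmall : |y| < 2 ^ (α.manBits + 1) * α.quantum
  · exact ⟨zero α, by rw [toRat_zero]; unfold ufpN; rw [if_pos hsmall]⟩
  · have hval : ufpN α y = 2 ^ (α.manBits + α.shift ⌊|y| / α.quantum⌋.toNat) * α.quantum := by
      unfold ufpN; rw [if_neg hsmall]
    set s := α.shift ⌊|y| / α.quantum⌋.toNat with hs
    -- 2^m · 2^s ≤ maxScaled, from ufpN y ≤ |y| ≤ maxRat
    have hle_rat : (2 : ℚ) ^ (α.manBits + s) * α.quantum ≤ (α.maxScaled : ℚ) * α.quantum := by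
      have := ufpN_le_abs (α := α) y
      rw [hval] at this
      exact le_trans this hy
    have hle : 2 ^ α.manBits * 2 ^ s ≤ α.maxScaled := by
      have h' : (2 : ℚ) ^ (α.manBits + s) ≤ α.maxScaled := le_of_mul_le_mul_right hle_rat hq
      rw [pow_add] at h'
      exact_mod_cast h'
    have hk : 2 ^ α.manBits < 2 ^ (α.manBits + 1) := Nat.pow_lt_pow_right (by norm_num) (by omega)
    have hrep : α.Representable (2 ^ α.manBits * 2 ^ s) := representable_mul_pow hk hle
    refine ⟨ofScaled α false _ hle, ?_⟩
    rw [toRat_ofScaled hle hrep, hval, pow_add]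
    push_cast
    simp

/-- KEY LOCAL FACT at a node of maximal binade: the error AND the binade floor fit inside the
argument, `|fl(a+b) - (a+b)| + ufpN(a+b) ≤ |a+b|` (the floor `±ufpN` is a value of `α`, and `fl`
is at least as close to `a+b` as that value). [folklore] -/
theorem abs_err_add_ufpN_le_abs (a b : MiniFloat α) (h : |a.toRat + b.toRat| ≤ α.maxRat) :
    |(roundNE α (a.toRat + b.toRat)).toRat - (a.toRat + b.toRat)| + ufpN α (a.toRat + b.toRat)
      ≤ |a.toRat + b.toRat| := by
  set y := a.toRat + b.toRat with hy
  obtain ⟨z, hz⟩ := exists_toRat_eq_ufpN (α := α) h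
  have hU := ufpN_le_abs (α := α) y
  have hU0 := ufpN_nonneg α y
  by_cases hsgn : 0 ≤ y
  · have hn := roundNE_nearest (φ := α) y z
    rw [hz, abs_of_nonneg hsgn] at *
    rw [abs_sub_comm] at hn
    have : |y - ufpN α y| = y - ufpN α y := abs_of_nonneg (by linarith)
    linarith
  · have hn := roundNE_nearest (φ := α) y z.flipSign
    rw [toRat_flipSign, hz] at hn
    have hyneg : y < 0 := not_le.mp hsgn
    rw [abs_of_neg hyneg] at hU ⊢
    rw [abs_sub_comm] at hn
    have : |y - -ufpN α y| = -y - ufpN α y := by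
      rw [sub_neg_eq_add, abs_of_nonpos (by linarith)]; ring
    linarith

/-! ### Trees: node counts, node predicates, the maximal binade -/

/-- Number of internal nodes (= floating-point additions, `n - 1` for `n` leaves). [folklore] -/
def numNodes : SumTree → ℕ
  | .leaf _ => 0
  | .node l r => numNodes l + numNodes r + 1

/-- `numNodes t + 1 = n`, the number of leaves. [folklore] -/
theorem numNodes_add_one : ∀ t : SumTree, numNodes t + 1 = t.leaves.length
  | .leaf _ => rfl
  | .node l r => by
      simp only [numNodes, SumTree.leaves, List.length_append, ← numNodes_add_one l,
        ← numNodes_add_one r]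
      omega

/-- `(numNodes t : ℚ) = n - 1`. [folklore] -/
theorem numNodes_cast (t : SumTree) : (numNodes t : ℚ) = (t.leaves.length : ℚ) - 1 := by
  rw [← numNodes_add_one t]; push_cast; ring

/-- Every internal node's exact argument (sum of the two evaluated children, in `α`) satisfies
`P`. [folklore] -/
def AllNodes (α : Format) (P : ℚ → Prop) : SumTree → Prop
  | .leaf _ => True
  | .node l r => AllNodes α P l ∧ AllNodes α P r ∧
      P (SumTree.eval (flα α) l + SumTree.eval (flα α) r)

/-- Some internal node's exact argument satisfies `P`. [folklore] -/
def SomeNode (α : Format) (P : ℚ → Prop) : SumTree → Prop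
  | .leaf _ => False
  | .node l r => SomeNode α P l ∨ SomeNode α P r ∨
      P (SumTree.eval (flα α) l + SumTree.eval (flα α) r)

/-- `AllNodes` is monotone in the predicate. [folklore] -/
theorem AllNodes.mono {P Q : ℚ → Prop} (hPQ : ∀ y, P y → Q y) :
    ∀ t : SumTree, AllNodes α P t → AllNodes α Q t
  | .leaf _, _ => trivial
  | .node l r, ⟨hl, hr, hroot⟩ => ⟨AllNodes.mono hPQ l hl, AllNodes.mono hPQ r hr, hPQ _ hroot⟩

/-- `AllNodes P` and no node with `Q` give `AllNodes (P ∧ ¬Q)`. [folklore] -/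
theorem AllNodes.and_not {P Q : ℚ → Prop} :
    ∀ t : SumTree, AllNodes α P t → ¬ SomeNode α Q t → AllNodes α (fun y => P y ∧ ¬ Q y) t
  | .leaf _, _, _ => trivial
  | .node l r, ⟨hl, hr, hroot⟩, hno => by
      simp only [SomeNode, not_or] at hno
      exact ⟨AllNodes.and_not l hl hno.1, AllNodes.and_not r hr hno.2.1, hroot, hno.2.2⟩

/-- The largest binade floor over the internal nodes (`0` for a leaf). [folklore] -/
noncomputable def maxUfp (α : Format) : SumTree → ℚ
  | .leaf _ => 0
  | .node l r => max (max (maxUfp α l) (maxUfp α r))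
      (ufpN α (SumTree.eval (flα α) l + SumTree.eval (flα α) r))

/-- Every node's binade floor is at most `maxUfp`. [folklore] -/
theorem allNodes_ufpN_le_maxUfp : ∀ t : SumTree, AllNodes α (fun y => ufpN α y ≤ maxUfp α t) t
  | .leaf _ => trivial
  | .node l r => by
      refine ⟨AllNodes.mono (fun y hy => ?_) l (allNodes_ufpN_le_maxUfp l),
        AllNodes.mono (fun y hy => ?_) r (allNodes_ufpN_le_maxUfp r), ?_⟩
      · exact le_trans hy (le_trans (le_max_left _ _) (le_max_left _ _))
      · exact le_trans hy (le_trans (le_max_right _ _) (le_max_left _ _))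
      · exact le_max_right _ _

/-- `maxUfp` is attained at some node of a tree with at least one addition. [folklore] -/
theorem someNode_ufpN_eq_maxUfp :
    ∀ t : SumTree, 0 < numNodes t → SomeNode α (fun y => ufpN α y = maxUfp α t) t
  | .leaf _, h => by simp [numNodes] at h
  | .node a b, _ => by
      simp only [SomeNode, maxUfp]
      set R := ufpN α (SumTree.eval (flα α) a + SumTree.eval (flα α) b)
      by_cases hR : max (maxUfp α a) (maxUfp α b) ≤ R
      · right; right; exact (max_eq_right hR).symm
      · have hR' : R < max (maxUfp α a) (maxUfp α b) := not_le.mp hR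
        rw [max_eq_left hR'.le]
        have hpos : 0 < max (maxUfp α a) (maxUfp α b) := lt_of_le_of_lt (ufpN_nonneg α _) hR'
        rcases le_total (maxUfp α b) (maxUfp α a) with hab | hab
        · rw [max_eq_left hab] at hpos ⊢
          have ha : 0 < numNodes a := by
            cases a with
            | leaf x => simp [maxUfp] at hpos
            | node _ _ => simp [numNodes]
          left; exact someNode_ufpN_eq_maxUfp a ha
        · rw [max_eq_right hab] at hpos ⊢
          have hb : 0 < numNodes b := by
            cases b with
            | leaf x => simp [maxUfp] at hpos
            | node _ _ => simp [numNodes]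
          right; left; exact someNode_ufpN_eq_maxUfp b hb

/-- `maxUfp ≥ 0`. [folklore] -/
theorem maxUfp_nonneg : ∀ t : SumTree, 0 ≤ maxUfp α t
  | .leaf _ => le_rfl
  | .node _ _ => le_trans (ufpN_nonneg α _) (le_max_right _ _)

/-- CAP LEMMA: if every node's binade floor is `≤ C`, the local errors total at most
`numNodes · u · C`. [folklore] -/
theorem absErr_le_numNodes_mul (hα : 2 ≤ α.emaxCode) {C : ℚ} :
    ∀ t : SumTree, TreeInRange α t → AllNodes α (fun y => ufpN α y ≤ C) t →
      absErr (flα α) t ≤ (numNodes t : ℚ) * (α.unitRoundoff * C)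
  | .leaf x, _, _ => by simp [absErr, SumTree.localErrors, numNodes]
  | .node l r, ⟨hl, hr, hrange⟩, ⟨hal, har, hroot⟩ => by
      have ihl := absErr_le_numNodes_mul hα l hl hal
      have ihr := absErr_le_numNodes_mul hα r hr har
      obtain ⟨yl, hyl⟩ := exists_toRat_eq_eval l hl
      obtain ⟨yr, hyr⟩ := exists_toRat_eq_eval r hr
      have hrange' : |yl.toRat + yr.toRat| ≤ α.maxRat := by rw [hyl, hyr]; exact hrange
      set e := |flα α (SumTree.eval (flα α) l + SumTree.eval (flα α) r)
        - (SumTree.eval (flα α) l + SumTree.eval (flα α) r)| with he_def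
      have he : e ≤ α.unitRoundoff * ufpN α (SumTree.eval (flα α) l + SumTree.eval (flα α) r) := by
        have := abs_err_roundNE_add_le_ufpN hα yl yr hrange'
        rw [hyl, hyr] at this
        exact this
      rw [absErr_node]
      simp only [numNodes]
      push_cast
      have hu := α.unitRoundoff_pos
      have : α.unitRoundoff * ufpN α (SumTree.eval (flα α) l + SumTree.eval (flα α) r)
          ≤ α.unitRoundoff * C := mul_le_mul_of_nonneg_left hroot hu.le
      have he' : e ≤ α.unitRoundoff * C := le_trans he this
      rw [← he_def]
      linarith

/-! ### The two bookkeeping inequalities (pure arithmetic) -/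

/-- Bookkeeping at the node of maximal binade: children below the cap `U/2` (`D₀ ≤ m·u·U/2`),
root error `e ≤ uU` fitting with `U` inside the argument (`U + e - D₀ ≤ T`), `2Ku ≤ 1`.
[folklore] -/
theorem langeRump_base_arith {u U D₀ e T : ℚ} {m K : ℕ} (hu : 0 < u)
    (hK : 2 * (K : ℚ) * u ≤ 1) (hmK : m + 1 ≤ K) (hD₀0 : 0 ≤ D₀)
    (hD₀ : D₀ ≤ (m : ℚ) * (u * (U / 2))) (he : e ≤ u * U) (hT : U + e - D₀ ≤ T) :
    D₀ + e - (K : ℚ) * u / (1 + (K : ℚ) * u) * T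
      ≤ -(((K : ℚ) - (m + 1)) * (u * U) / (1 + (K : ℚ) * u)) := by
  have hK0 : (0 : ℚ) ≤ K := Nat.cast_nonneg K
  have hKu : 0 ≤ (K : ℚ) * u := mul_nonneg hK0 hu.le
  have hden : 0 < 1 + (K : ℚ) * u := by linarith
  rw [div_mul_eq_mul_div, sub_le_iff_le_add, ← neg_div, ← add_div, le_div_iff₀ hden]
  have h1 : (K : ℚ) * u * (U + e - D₀) ≤ (K : ℚ) * u * T := mul_le_mul_of_nonneg_left hT hKu
  have h2 : 2 * (K : ℚ) * u * D₀ ≤ D₀ := by nlinarith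
  have hmK' : (m : ℚ) + 1 ≤ K := by exact_mod_cast hmK
  nlinarith

/-- Bookkeeping at an ancestor: a disjoint subtree `B` (`k_B` additions, leaf mass `T`, error
`D ≤ k_B u/(1+k_B u)·T`) joined by one rounding of error `e ≤ min(T + D, uU)` consumes at most
`(k_B + 1)·u·U/(1+Ku)` of slack. [folklore] -/
theorem langeRump_step_arith {u U D T e : ℚ} {kB K : ℕ} (hu : 0 < u) (hu2 : 2 * u ≤ 1)
    (hU : 0 ≤ U) (hK : 2 * (K : ℚ) * u ≤ 1) (hkBK : kB ≤ K) (hT : 0 ≤ T) (hD0 : 0 ≤ D)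
    (hD : D ≤ (kB : ℚ) * u / (1 + (kB : ℚ) * u) * T) (he1 : e ≤ T + D)
    (he2 : e ≤ u * U) :
    D + e - (K : ℚ) * u / (1 + (K : ℚ) * u) * T
      ≤ ((kB : ℚ) + 1) * (u * U) / (1 + (K : ℚ) * u) := by
  have hK0 : (0 : ℚ) ≤ K := Nat.cast_nonneg K
  have hkB0 : (0 : ℚ) ≤ kB := Nat.cast_nonneg kB
  have hKu : 0 ≤ (K : ℚ) * u := mul_nonneg hK0 hu.le
  have hkBu : 0 ≤ (kB : ℚ) * u := mul_nonneg hkB0 hu.le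
  have hden : 0 < 1 + (K : ℚ) * u := by linarith
  have hdenB : 0 < 1 + (kB : ℚ) * u := by linarith
  have hkBK' : (kB : ℚ) ≤ K := by exact_mod_cast hkBK
  have huU : 0 ≤ u * U := mul_nonneg hu.le hU
  -- D (1 + kB u) ≤ kB u T
  have hD' : D * (1 + (kB : ℚ) * u) ≤ (kB : ℚ) * u * T := by
    rw [div_mul_eq_mul_div, le_div_iff₀ hdenB] at hD; exact hD
  -- hence D ≤ kB u T, D ≤ T and (1 + K u) D ≤ K u T
  have hDT : D ≤ (kB : ℚ) * u * T := by nlinarith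
  have hDleT : D ≤ T := by
    have : (kB : ℚ) * u * T ≤ (1 + (kB : ℚ) * u) * T := by nlinarith
    nlinarith
  have hKD : (1 + (K : ℚ) * u) * D ≤ (K : ℚ) * u * T := by
    have : 0 ≤ ((K : ℚ) - kB) * u * (T - D) :=
      mul_nonneg (mul_nonneg (by linarith) hu.le) (by linarith)
    nlinarith
  rw [div_mul_eq_mul_div, sub_le_iff_le_add, ← add_div, le_div_iff₀ hden]
  -- goal: (D + e) * (1 + K u) ≤ (kB + 1) u U + K u T
  by_cases hc : u * U ≤ T + D
  · rcases Nat.eq_zero_or_pos kB with hk0 | hk1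
    · -- a single leaf: D = 0 and T ≥ u U
      subst hk0
      have hD0' : D = 0 := le_antisymm (by simpa using hD') hD0
      subst hD0'
      have p1 : 0 ≤ (u * U - e) * (1 + (K : ℚ) * u) := mul_nonneg (by linarith) hden.le
      have p2 : 0 ≤ (K : ℚ) * u * (T - u * U) := mul_nonneg hKu (by linarith)
      push_cast
      nlinarith
    · -- a proper subtree: K u ≤ 1/2 ≤ 1 ≤ kB
      have hk1' : (1 : ℚ) ≤ kB := by exact_mod_cast hk1
      have p3 : e * (1 + (K : ℚ) * u) ≤ u * U * (1 + (K : ℚ) * u) :=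
        mul_le_mul_of_nonneg_right he2 hden.le
      have p4 : (K : ℚ) * u * (u * U) ≤ (kB : ℚ) * (u * U) :=
        mul_le_mul_of_nonneg_right (by linarith) huU
      nlinarith
  · have hc' : T + D < u * U := not_le.mp hc
    have p5 : e * (1 + (K : ℚ) * u) ≤ (T + D) * (1 + (K : ℚ) * u) :=
      mul_le_mul_of_nonneg_right he1 hden.le
    have p6 : 2 * (K : ℚ) * u * D ≤ D := by nlinarith
    have p7 : (kB : ℚ) * u * T ≤ (kB : ℚ) * u * (u * U) :=
      mul_le_mul_of_nonneg_left (by linarith) hkBu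
    have p8 : (kB : ℚ) * u * (u * U) * 2 ≤ (kB : ℚ) * (u * U) := by nlinarith
    nlinarith

end MiniFloat

end Literature.ComputerArithmetic.FloatingPoint
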